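import Mathlib

/-!
# SoloBlind artefact 24 — the optimisation step of the CAP THEOREM for Landau's conversion
(`paper/sharpest.md` §1 (xix), `work/s20/cap-lemma.md`; claim C89)

Context (soloist `solo-RiemannHypothesis-blind`, session s20).  Landau's Hauptsatz / Titchmarsh's Theorem 3.10
converts an upper bound `ζ(s) = O(e^{φ(t)})` on `1 - θ(t) ≤ σ ≤ 2` into the zero-free region
`σ ≥ 1 - A₁ θ(2t+1)/φ(2t+1)`.  The report's CAP THEOREM bounds the output of this conversion for EVERY admissible
input pair: writing `u = log log T`, `θ = x/u` and using the uniform Ω-theorem of Bondarenko–Seip (2018, Thm 1) in the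
form `φ ≥ log u - C + e^x/(2x)` (`1 ≤ x ≤ u/4`), the width is at most `A₁ · sup_x (x/u)/(D + e^x/(2x))` with
`D = log u - C`.  The purely real-variable heart of the argument is the bound `sup_{x>0} x/(D + e^x/(2x)) ≤ 2 log D / D`,
kernel-checked below for `D ≥ 49` (the report proves the asymptotic constant `1 + o(1)` in place of `2` in prose).
Consequence in the report: no true input whatsoever makes the conversion yield a region wider than
`(2A₁+o(1))·log₄t/(log₂t·log₃t)`; under RH an input exists giving `(A₁/2-o(1))·log₄t/(log₂t·log₃t)`.
Mathlib only; no sorries.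
-/

namespace Summit.RiemannHypothesis.RiemannHypothesis.Theorems

/-- Numerical fact: `log 49 < 4` (since `e^4 > 2.718^4 > 54 > 49`). -/
theorem soloBlind_log49_lt_four : Real.log 49 < 4 := by
  have he := Real.exp_one_gt_d9
  have hpow : (2.7182818283 : ℝ) ^ 4 < Real.exp 1 ^ 4 := by gcongr
  have h4 : Real.exp 4 = Real.exp 1 ^ 4 := by
    rw [show (4 : ℝ) = ((4 : ℕ) : ℝ) * 1 by norm_num, Real.exp_nat_mul]
  have h : (49 : ℝ) < Real.exp 4 := by
    rw [h4]; nlinarith [hpow]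
  calc Real.log 49 < Real.log (Real.exp 4) := Real.log_lt_log (by norm_num) h
    _ = 4 := Real.log_exp 4

/-- Numerical fact: `1 < log 49` (since `e < 2.72 < 49`). -/
theorem soloBlind_one_lt_log49 : 1 < Real.log 49 := by
  have h : Real.exp 1 < 49 := by have := Real.exp_one_lt_d9; linarith
  calc (1 : ℝ) = Real.log (Real.exp 1) := (Real.log_exp 1).symm
    _ < Real.log 49 := Real.log_lt_log (Real.exp_pos 1) h

/-- For `D ≥ 49`: `4 log D ≤ D`. -/
theorem soloBlind_four_log_le (D : ℝ) (hD : 49 ≤ D) : 4 * Real.log D ≤ D := by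
  have hq : Real.log (D / 49) ≤ D / 49 - 1 := Real.log_le_sub_one_of_pos (by positivity)
  have hsplit : Real.log D = Real.log 49 + Real.log (D / 49) := by
    rw [Real.log_div (by linarith) (by norm_num)]; ring
  have h49 := soloBlind_log49_lt_four
  rw [hsplit]; nlinarith

/-- **Optimisation core of the cap theorem.**  For `D ≥ 49` and every `x > 0`,
`x / (D + e^x/(2x)) ≤ 2 log D / D`.  (In the report: `D = log₃T - C`, `x = θ·log₂T`; the left side times `A₁/log₂T`
bounds the width of the zero-free region produced by Titchmarsh's Theorem 3.10 from any admissible input.) -/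
theorem soloBlind_landauCap_core (D x : ℝ) (hD : 49 ≤ D) (hx : 0 < x) :
    x / (D + Real.exp x / (2 * x)) ≤ 2 * Real.log D / D := by
  have hDpos : 0 < D := by linarith
  have hD4 : 4 ≤ D := by linarith
  have hL1 : 1 < Real.log D :=
    lt_of_lt_of_le soloBlind_one_lt_log49 (Real.log_le_log (by norm_num) hD)
  have hLpos : 0 < Real.log D := by linarith
  have h4 : 4 * Real.log D ≤ D := soloBlind_four_log_le D hD
  have hLD2 : 2 ≤ Real.log D * D := by nlinarith
  have hE : 0 < Real.exp x := Real.exp_pos x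
  have hx0 : x ≠ 0 := hx.ne'
  have hden : 0 < D + Real.exp x / (2 * x) := by positivity
  rw [div_le_div_iff₀ hden hDpos]
  have hexp : 2 * Real.log D * (D + Real.exp x / (2 * x))
      = 2 * Real.log D * D + Real.log D * Real.exp x / x := by
    field_simp
  rw [hexp]
  have hpos2 : 0 ≤ Real.log D * Real.exp x / x := by positivity
  by_cases hcase : x ≤ 2 * Real.log D
  · nlinarith
  · have hcase : 2 * Real.log D < x := lt_of_not_ge hcase
    set y := x - 2 * Real.log D with hy
    have hy0 : 0 < y := by linarith
    have hxy : x = 2 * Real.log D + y := by linarith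
    have hex : Real.exp x = D ^ 2 * Real.exp y := by
      rw [hxy, Real.exp_add, show 2 * Real.log D = Real.log D + Real.log D by ring, Real.exp_add,
        Real.exp_log hDpos]
      ring
    have hq : 1 + y + y ^ 2 / 2 ≤ Real.exp y := Real.quadratic_le_exp_of_nonneg hy0.le
    have hq' : Real.log D * D * (1 + y + y ^ 2 / 2) ≤ Real.log D * D * Real.exp y :=
      mul_le_mul_of_nonneg_left hq (by positivity)
    have e1 : 4 * Real.log D ^ 2 ≤ Real.log D * D := by nlinarith
    have e2 : 4 * Real.log D * y ≤ Real.log D * D * y := by nlinarith [mul_pos hLpos hy0]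
    have e3 : y ^ 2 ≤ Real.log D * D * y ^ 2 / 2 := by nlinarith [sq_nonneg y]
    have hkey : (2 * Real.log D + y) ^ 2 ≤ Real.log D * D * Real.exp y := by nlinarith
    have hkey' : x ^ 2 * D ≤ Real.log D * Real.exp x := by
      rw [hex, hxy]
      calc (2 * Real.log D + y) ^ 2 * D ≤ Real.log D * D * Real.exp y * D :=
            mul_le_mul_of_nonneg_right hkey hDpos.le
        _ = Real.log D * (D ^ 2 * Real.exp y) := by ring
    have h1 : x * D * x ≤ Real.log D * Real.exp x := by nlinarith [hkey']
    have h2 : x * D ≤ Real.log D * Real.exp x / x := by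
      rw [le_div_iff₀ hx]; exact h1
    nlinarith

/-- The width form used in the report: with `u = log log T > 0` and `θ = x/u`, the Landau/Titchmarsh width
`θ/φ ≤ (x/u)/(D + e^x/(2x))` is at most `2 log D/(D·u)`, uniformly in `x > 0`. -/
theorem soloBlind_landauCap_width (D u x : ℝ) (hD : 49 ≤ D) (hu : 0 < u) (hx : 0 < x) :
    (x / u) / (D + Real.exp x / (2 * x)) ≤ 2 * Real.log D / D / u := by
  have h := soloBlind_landauCap_core D x hD hx
  have hden : 0 < D + Real.exp x / (2 * x) := by positivity
  rw [div_div, mul_comm u, ← div_div]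
  exact div_le_div_of_nonneg_right h hu.le

end Summit.RiemannHypothesis.RiemannHypothesis.Theorems
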